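import Summits.ResolutionOfSingularities.ResolutionOfSingularities.Theorems.FibrewiseClosedPoints.Negative.AlmostDecoration
import Summits.ResolutionOfSingularities.ResolutionOfSingularities.Theorems.SectionAscentFibrewiseClosedPointsLowDimPoint
import Mathlib.RingTheory.Ideal.KrullsHeightTheorem

/-!
# `FibrewiseClosedPoints` — negative lemmas IV: the exact-support clause excludes the finite junk
(Krull's Hauptidealsatz at a normal singular point)

Support (negative) lemmas for crux `stmt-ResolutionOfSingularities-15960`
(`Summit.ResolutionOfSingularities.ResolutionOfSingularities.Theses.SectionAscent.FibrewiseClosedPoints`,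
route SectionAscent: `∀ p prime, ∀ d, OneShot p d → Almost p (d+1) → OneShot p (d+1)`), filed by the
standing crux disprover (cdisprove, generation 2, cycle 1, 2026-08-17). No `Prop` is defined and no
declaration concludes a route decl positively.

Load-bearing analysis of the two clauses that distinguish the conclusion `OneShot` from the
hypothesis `Almost` of the crux. The landed `Negative/AlmostDecoration.lean` shows that the
HYPOTHESIS `Almost` is met by junk — a principal centre `(f)` on a normal variety
(`almostBody_span_singleton`: `Bl_(f) ≅ Spec A`, and the fibre clause "regular at every point not
closed in its fibre" is vacuous because the blowing up is an isomorphism). The hypothesis only asks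
`V(I) ⊇ Sing`. This file certifies in the kernel what the EXACT-SUPPORT clause of `OneShot`
(`I ≤ 𝔭 ↔ A_𝔭 not regular`, i.e. `V(I) = Sing` on the nose) does to that junk, with no blowing up
and no resolution content at all:

* `isRegularLocalRing_localization_of_mem_minimalPrimes_span_singleton` — in a normal Noetherian
  domain every prime MINIMAL over a principal ideal is a regular point (Krull: height `≤ 1`; a
  normal Noetherian local domain of dimension `≤ 1` is a field or a DVR, tree
  `LowDimPoint.isRegularLocalRing_of_isIntegrallyClosed_of_ringKrullDim_le_one`).
* `exists_le_isRegularLocalRing_of_mem` — hence every principal ideal through a point `𝔮` passes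
  through a REGULAR point generising `𝔮`: on a normal variety `V(f)` is never inside `Sing`.
* `exactSupport_span_singleton_iff` — **the exact-support clause for a principal centre holds iff
  `f` is a unit AND `A` is regular everywhere.** So at a normal variety with a singular point NO
  principal ideal is an admissible `OneShot` centre (`not_exactSupport_span_singleton`), although
  every principal `(f)` with `D(f) ⊆ Reg` is an admissible `Almost` centre
  (`almostBody_and_not_exactSupport_span_singleton`, the contrast in one statement). For the
  planner's repair: adding the exact-support clause to `Almost` removes the identity/normalisation
  junk at every normal singular point, in every dimension and characteristic.
* `exists_mem_and_lt_maximalIdeal` — local form (any Noetherian local ring of dimension `≥ 2`): a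
  non-unit `f` lies in a prime strictly below the maximal ideal, i.e. the zero set of an invertible
  ideal at a point of dimension `≥ 2` is never that point alone. Geometric reading (recorded for the
  provers of `stub_supportSharpening`, not formalised): if `Bl_I(Spec A)` is regular with
  `V(I) = Sing(Spec A)`, its exceptional locus `π⁻¹(Sing) = V(I·𝒪)` is locally `V(f)` and therefore
  DIVISORIAL through every point of dimension `≥ 2`; a strong resolution with a small
  (codimension `≥ 2`) exceptional set — `Bl_{(x,z)}` of the cone `xy = zw`, an isomorphism off the
  vertex with exceptional `ℙ¹` — is thus never a one-shot blowing up with exact support, which is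
  why "projective resolution, iso over `Reg`" (Cossart–Piltant in dimension `3`) does not by itself
  give `OneShot`, and why Hartshorne II.7.17 presents such a `π` only as `Bl_J` with NO control of
  `V(J)`.

## Sources
* H. Matsumura, *Commutative Ring Theory*, CUP 1986, Thm 13.5 (Krull's principal ideal theorem),
  Thm 11.2 (normal Noetherian local domains of dimension `1` are DVRs). [Matsumura1987]
* V. Cossart, O. Piltant, *Resolution of singularities of arithmetical threefolds*, J. Algebra 529
  (2019), p. 3 (whether `π` is a blowing up with zero locus `Sing 𝒳` is open in dimension `3`).
  [CossartPiltant2019]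
* R. Hartshorne, *Algebraic Geometry*, GTM 52, Thm II.7.17. [Hartshorne1977]
-/

noncomputable section

set_option linter.dupNamespace false -- mandated namespace of this single-conjunct summit

open Literature.AlgebraicGeometry.Resolution
open Summit.ResolutionOfSingularities.ResolutionOfSingularities.Theses.SectionAscent

namespace Summit.ResolutionOfSingularities.ResolutionOfSingularities.Theorems.FibrewiseClosedPoints.Negative

universe u

section Normal

variable {A : Type u} [CommRing A] [IsDomain A] [IsNoetherianRing A] [IsIntegrallyClosed A]

/-- **Primes minimal over a principal ideal of a normal Noetherian domain are regular points.**
By Krull's Hauptidealsatz such a prime `𝔭` has height `≤ 1`, so `A_𝔭` is a normal Noetherian local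
domain of Krull dimension `≤ 1`, i.e. a field or a discrete valuation ring — regular.
[cite: Matsumura1987, Thm 13.5 and Thm 11.2] -/
theorem isRegularLocalRing_localization_of_mem_minimalPrimes_span_singleton (f : A)
    (𝔭 : PrimeSpectrum A) (h𝔭 : 𝔭.asIdeal ∈ (Ideal.span {f}).minimalPrimes) :
    IsRegularLocalRing (Localization.AtPrime 𝔭.asIdeal) := by
  have hle : 𝔭.asIdeal.height ≤ 1 :=
    Ideal.height_le_one_of_isPrincipal_of_mem_minimalPrimes _ _ h𝔭
  have hdim : ringKrullDim (Localization.AtPrime 𝔭.asIdeal) ≤ 1 := by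
    rw [IsLocalization.AtPrime.ringKrullDim_eq_height 𝔭.asIdeal (Localization.AtPrime 𝔭.asIdeal)]
    exact_mod_cast hle
  have hnorm : IsIntegrallyClosed (Localization.AtPrime 𝔭.asIdeal) :=
    isIntegrallyClosed_of_isLocalization _ 𝔭.asIdeal.primeCompl
      (Ideal.primeCompl_le_nonZeroDivisors _)
  exact SectionAscent.LowDimPoint.isRegularLocalRing_of_isIntegrallyClosed_of_ringKrullDim_le_one
    _ hnorm hdim

/-- **Every principal ideal through a point passes through a regular point generising it**: for
`f ∈ 𝔮` in a normal Noetherian domain there is a prime `𝔭 ⊆ 𝔮` containing `f` with `A_𝔭`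
regular (a prime minimal over `(f)` inside `𝔮`). On a normal variety, `V(f) ⊄ Sing`. [folklore] -/
theorem exists_le_isRegularLocalRing_of_mem (f : A) (𝔮 : PrimeSpectrum A) (hf : f ∈ 𝔮.asIdeal) :
    ∃ 𝔭 : PrimeSpectrum A, f ∈ 𝔭.asIdeal ∧ 𝔭.asIdeal ≤ 𝔮.asIdeal ∧
      IsRegularLocalRing (Localization.AtPrime 𝔭.asIdeal) := by
  obtain ⟨p, hp, hpq⟩ :=
    Ideal.exists_minimalPrimes_le ((Ideal.span_singleton_le_iff_mem 𝔮.asIdeal).mpr hf)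
  refine ⟨⟨p, hp.1.1⟩, (Ideal.span_singleton_le_iff_mem _).mp hp.1.2, hpq, ?_⟩
  exact isRegularLocalRing_localization_of_mem_minimalPrimes_span_singleton f ⟨p, hp.1.1⟩ hp

/-- **The exact-support clause for a principal centre.** On a normal Noetherian domain the clause
`∀ 𝔭, (f) ≤ 𝔭 ↔ A_𝔭 not regular` of the route's `OneShot` holds for `I = (f)` iff `f` is a unit
AND every local ring of `A` is regular: the clause forces `f` out of every singular prime's
generisations down to height `≤ 1`, where `A` is regular. [folklore] -/
theorem exactSupport_span_singleton_iff (f : A) :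
    (∀ 𝔭 : PrimeSpectrum A, Ideal.span {f} ≤ 𝔭.asIdeal ↔
        ¬ IsRegularLocalRing (Localization.AtPrime 𝔭.asIdeal)) ↔
      IsUnit f ∧ ∀ 𝔭 : PrimeSpectrum A, IsRegularLocalRing (Localization.AtPrime 𝔭.asIdeal) := by
  constructor
  · intro h
    have hunit : IsUnit f := by
      by_contra hnu
      obtain ⟨𝔪, h𝔪, hf𝔪⟩ := exists_max_ideal_of_mem_nonunits (mem_nonunits_iff.mpr hnu)
      obtain ⟨𝔭, hf𝔭, -, hreg⟩ := exists_le_isRegularLocalRing_of_mem f ⟨𝔪, h𝔪.isPrime⟩ hf𝔪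
      exact (h 𝔭).mp ((Ideal.span_singleton_le_iff_mem _).mpr hf𝔭) hreg
    refine ⟨hunit, fun 𝔭 => ?_⟩
    by_contra hreg
    have hle := (h 𝔭).mpr hreg
    rw [Ideal.span_singleton_eq_top.mpr hunit, top_le_iff] at hle
    exact 𝔭.isPrime.ne_top hle
  · rintro ⟨hunit, hreg⟩ 𝔭
    rw [Ideal.span_singleton_eq_top.mpr hunit]
    constructor
    · exact fun hle => absurd (top_le_iff.mp hle) 𝔭.isPrime.ne_top
    · exact fun hn => absurd (hreg 𝔭) hn

/-- **At a normal variety with a singular point, no principal ideal is an admissible `OneShot`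
centre**: the exact-support clause already fails, before any blowing up is formed. (For the WEAK
conclusion — no support clause — principal centres fail for a different reason, landed
`not_isRegular_affineBlowup_span_singleton`: `Bl_(f) ≅ Spec A` is not regular.) [folklore] -/
theorem not_exactSupport_span_singleton
    (hsing : ∃ 𝔮 : PrimeSpectrum A, ¬ IsRegularLocalRing (Localization.AtPrime 𝔮.asIdeal))
    (f : A) :
    ¬ ∀ 𝔭 : PrimeSpectrum A, Ideal.span {f} ≤ 𝔭.asIdeal ↔
        ¬ IsRegularLocalRing (Localization.AtPrime 𝔭.asIdeal) := by
  intro h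
  obtain ⟨𝔮, h𝔮⟩ := hsing
  exact h𝔮 (((exactSupport_span_singleton_iff f).mp h).2 𝔮)

/-- **Hypothesis junk versus conclusion, in one statement.** On a normal domain with a singular
point, a principal centre `(f)`, `f ≠ 0`, `D(f) ⊆ Reg`, satisfies the whole body of the crux's
hypothesis `Almost` (landed `almostBody_span_singleton`) and violates the support clause of its
conclusion `OneShot`. The two predicates differ exactly by "exact support + regular (not merely
normal) blowing up"; the first difference alone separates them on every normal singular variety.
[folklore] -/
theorem almostBody_and_not_exactSupport_span_singleton {f : A} (hf : f ≠ 0)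
    (hreg : ∀ 𝔭 : PrimeSpectrum A, f ∉ 𝔭.asIdeal →
      IsRegularLocalRing (Localization.AtPrime 𝔭.asIdeal))
    (hsing : ∃ 𝔮 : PrimeSpectrum A, ¬ IsRegularLocalRing (Localization.AtPrime 𝔮.asIdeal)) :
    (Ideal.span {f} ≠ ⊥ ∧
      (∀ 𝔭 : PrimeSpectrum A, ¬ Ideal.span {f} ≤ 𝔭.asIdeal →
        IsRegularLocalRing (Localization.AtPrime 𝔭.asIdeal)) ∧
      (∀ y : affineBlowup (Ideal.span {f}),
        IsIntegrallyClosed ((affineBlowup (Ideal.span {f})).presheaf.stalk y)) ∧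
      ∀ y : affineBlowup (Ideal.span {f}),
        (∃ z : affineBlowup (Ideal.span {f}), z ≠ y ∧ y ⤳ z ∧
          (affineBlowup.π (Ideal.span {f})).base z = (affineBlowup.π (Ideal.span {f})).base y) →
        IsRegularLocalRing ((affineBlowup (Ideal.span {f})).presheaf.stalk y)) ∧
    ¬ ∀ 𝔭 : PrimeSpectrum A, Ideal.span {f} ≤ 𝔭.asIdeal ↔
        ¬ IsRegularLocalRing (Localization.AtPrime 𝔭.asIdeal) :=
  ⟨almostBody_span_singleton hf hreg, not_exactSupport_span_singleton hsing f⟩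

end Normal

section Local

/-- **Local form: the zero set of an invertible ideal at a point of dimension `≥ 2` is never the
point alone.** In a Noetherian local ring whose maximal ideal has height `> 1`, every element of
the maximal ideal lies in a prime STRICTLY below it (a prime minimal over `(f)` has height `≤ 1`
by Krull). Geometrically: the exceptional locus `V(I·𝒪)` of a blowing up is divisorial, so a
one-shot resolution `Bl_I`, `V(I) = Sing`, has positive-dimensional fibres over every singular
point of dimension `≥ 2` of a normal variety, and a small strong resolution (exceptional set of
codimension `≥ 2`, e.g. `Bl_{(x,z)}` of `xy = zw`) is not of this form.
[cite: Matsumura1987, Thm 13.5] -/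
theorem exists_mem_and_lt_maximalIdeal {R : Type u} [CommRing R] [IsNoetherianRing R]
    [IsLocalRing R] {f : R} (hf : f ∈ IsLocalRing.maximalIdeal R)
    (hdim : 1 < (IsLocalRing.maximalIdeal R).height) :
    ∃ 𝔭 : Ideal R, 𝔭.IsPrime ∧ f ∈ 𝔭 ∧ 𝔭 < IsLocalRing.maximalIdeal R := by
  obtain ⟨p, hp, hple⟩ :=
    Ideal.exists_minimalPrimes_le ((Ideal.span_singleton_le_iff_mem _).mpr hf)
  refine ⟨p, hp.1.1, (Ideal.span_singleton_le_iff_mem _).mp hp.1.2, lt_of_le_of_ne hple ?_⟩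
  intro hpm
  have hle : p.height ≤ 1 := Ideal.height_le_one_of_isPrincipal_of_mem_minimalPrimes _ _ hp
  rw [hpm] at hle
  exact absurd (lt_of_lt_of_le hdim hle) (lt_irrefl _)

/-- The same with the dimension hypothesis on `ringKrullDim R` (`= height 𝔪` for a Noetherian
local ring). [folklore] -/
theorem exists_mem_and_lt_maximalIdeal_of_ringKrullDim {R : Type u} [CommRing R]
    [IsNoetherianRing R] [IsLocalRing R] {f : R} (hf : f ∈ IsLocalRing.maximalIdeal R)
    (hdim : 1 < ringKrullDim R) :
    ∃ 𝔭 : Ideal R, 𝔭.IsPrime ∧ f ∈ 𝔭 ∧ 𝔭 < IsLocalRing.maximalIdeal R := by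
  refine exists_mem_and_lt_maximalIdeal hf ?_
  rw [← IsLocalRing.maximalIdeal_height_eq_ringKrullDim] at hdim
  exact_mod_cast hdim

end Local

end Summit.ResolutionOfSingularities.ResolutionOfSingularities.Theorems.FibrewiseClosedPoints.Negative

end
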